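import Literature.MathematicalPhysics.KineticTheory.PrefixRungScaling
import HarnessLib

/-!
# CEHR §5.1 scaling for the cell block of the prefix cell chain, II: the rescaled drift is the limit drift up to `O(1/K)`

Trunk T-KINETIC (Literature/MathematicalPhysics/KineticTheory). Continuation of
`PrefixRungScaling.lean` (the cell-block projection `prefixRungProj`, the limit cell chain of the prefix
rung `cellChain ω₂ lam β γ (· < k)` and its drift). Cuneo–Eckmann–Hairer–Rey-Bellet 2018 §5.1
eq. (5.12) bounds the difference between the rescaled force `E^{1/ℓ-1}∇H(E^{1/ℓ}q̃)` and its homogeneous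
limit; for the MIXED rung (degree 4 on the cells, 2 on the host — outside their Condition C3, Rem. 2.11)
the same computation on the CELL BLOCK `[0, k]` leaves, besides the degree-2 pinning and bond terms of
the cells and the friction, exactly one new term: the harmonic bond `k` to the first host site, whose
position may be as large as `O(K²)` at energy `K⁴` but enters the rescaled cell-block force only as
`K⁻³ · O(K²) = O(1/K)`:

* `prefixRung_proj_scaledDrift_sub_limit_le` — if `|qᵢ| ≤ Cq K` and `|pᵢ| ≤ Cp K²` on the cell block
  `i ≤ k` and `|q_{k+1}| ≤ Ch K²`, then
  `‖π(K⁻¹ • rescale K (Y w)) - Ŷ₀(π(rescale K w))‖ ≤ (ω₂Cq + 4Cq + Ch + 2γCp)/K` (sup norm; the cubic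
  terms cancel exactly, site by site, including at the interface site `k` where the limit chain has no
  pinning and no bond to the right).

## References

* N. Cuneo, J.-P. Eckmann, M. Hairer, L. Rey-Bellet, EJP 23 (2018) no. 55 (arXiv:1712.09413), §5.1
  eqs. (5.8), (5.12); Remark 2.11.
-/

noncomputable section

open MeasureTheory Filter Topology Set Metric Function
open scoped NNReal

namespace Literature.MathematicalPhysics.KineticTheory.HeatConduction

open OscillatorChain

section Perturbation

/- The limit cell chain of the prefix rung, as a structure literal (notation only, as in
`PrefixRungScaling.lean`). -/
set_option quotPrecheck false in
local notation "P₀⟦" lam ", " β ", " k "⟧" =>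
  (SiteChain.mk (fun i q => (if i < k then lam else 0) * q ^ 4 / 4) (fun _ r => β * r ^ 4 / 4) 0)

variable {lam β : ℝ} (k : ℕ)

/-! ### The perturbation: the cell block of the rescaled drift of the prefix rung is the limit drift up to `O(1/K)` -/

/-- `|K⁻¹ ((K²)⁻¹ X)| ≤ B/K` when `|X| ≤ B K²` (`K > 0`). [folklore] -/
theorem abs_inv_mul_inv_sq_mul_le {K X B : ℝ} (hK : 0 < K) (hX : |X| ≤ B * K ^ 2) :
    |K⁻¹ * ((K ^ 2)⁻¹ * X)| ≤ B / K := by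
  have hK2 : 0 < K ^ 2 := by positivity
  rw [abs_mul, abs_mul, abs_of_pos (inv_pos.2 hK), abs_of_pos (inv_pos.2 hK2), div_eq_mul_inv, mul_comm]
  refine mul_le_mul_of_nonneg_right ?_ (inv_pos.2 hK).le
  rwa [← div_eq_inv_mul, div_le_iff₀ hK2]

/-- The cubic (degree-3) part of the sitewise force of the prefix rung at a cell site, rescaled by
`K⁻³`, IS the sitewise force of the limit cell chain at the rescaled positions; what remains are the
degree-1 forces (harmonic pinning, harmonic parts of the bonds — including the bond `k` to the first
HOST site) at size `K⁻³ · O(K²)`, and the friction `γ K⁻³ p`. Quantitatively: if `|qᵢ| ≤ Cq K` on the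
cell block `i ≤ k`, `|q_{k+1}| ≤ Ch K²` and `|pᵢ| ≤ Cp K²` on the cell block (`K ≥ 1`), then
`‖π(K⁻¹ • rescale K (Y w)) - Ŷ₀(π(rescale K w))‖ ≤ (ω₂Cq + 4Cq + Ch + 2γCp)/K`.
[cite: CuneoEckmannHairerReyBellet2018, §5.1 eq. (5.12)] -/
theorem prefixRung_proj_scaledDrift_sub_limit_le {ω₂ γ : ℝ} {N : ℕ} (hω : 0 < ω₂) (hl : 0 ≤ lam)
    (hβ : 0 ≤ β) (hγ : 0 ≤ γ) (hkN : k + 1 ≤ N) {K Cq Ch Cp : ℝ} (hK : 1 ≤ K) (hCq : 0 ≤ Cq)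
    (hCh : 0 ≤ Ch) (hCp : 0 ≤ Cp) (w : PhaseSpace N)
    (hq : ∀ i : Fin N, i.val ≤ k → |w.1 i| ≤ Cq * K)
    (hh : ∀ i : Fin N, i.val = k + 1 → |w.1 i| ≤ Ch * K ^ 2)
    (hp : ∀ i : Fin N, i.val ≤ k → |w.2 i| ≤ Cp * K ^ 2) :
    ‖prefixRungProj k N hkN
          (K⁻¹ • rescale K ((cellChain ω₂ lam β γ (fun i => decide (i < k))).langevinDrift N w)) -
        SiteChain.langevinDrift P₀⟦lam, β, k⟧ (k + 1) (prefixRungProj k N hkN (rescale K w))‖ ≤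
      (ω₂ * Cq + 4 * Cq + Ch + 2 * γ * Cp) / K := by
  set P := cellChain ω₂ lam β γ (fun i => decide (i < k)) with hP
  have hUC := cellChain_uniformlyConfining hω hl hβ hγ (fun i => decide (i < k))
  have hYw : P.langevinDrift N w =
      (w.2, fun i => -P.dPotential N i w.1 - γ * bathWeight N i * w.2 i) := by
    rw [SiteChain.langevinDrift_eq _ hUC.differentiable_U hUC.differentiable_V]
    rfl
  have hK0 : 0 < K := by linarith
  have hKK : K ≤ K ^ 2 := by nlinarith
  set Cpert := ω₂ * Cq + 4 * Cq + Ch + 2 * γ * Cp with hCpert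
  have hCpert0 : 0 ≤ Cpert := by positivity
  have hgoal0 : 0 ≤ Cpert / K := by positivity
  rw [prefixLimit_langevinDrift_eq]
  refine (Prod.norm_def _).le.trans (max_le ?_ ?_)
  · -- position components agree exactly
    refine (pi_norm_le_iff_of_nonneg hgoal0).2 fun i => ?_
    have e : (prefixRungProj k N hkN (K⁻¹ • rescale K (P.langevinDrift N w)) -
        ((prefixRungProj k N hkN (rescale K w)).2,
          fun i => -(P₀⟦lam, β, k⟧.dPotential (k + 1) i (prefixRungProj k N hkN (rescale K w)).1))).1 i = 0 := by
      simp only [Prod.fst_sub, Pi.sub_apply, prefixRungProj_fst, prefixRungProj_snd, Prod.smul_fst,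
        Pi.smul_apply, rescale_fst, rescale_snd, smul_eq_mul, hYw]
      ring
    rw [e, norm_zero]; exact hgoal0
  · refine (pi_norm_le_iff_of_nonneg hgoal0).2 fun i => ?_
    have hik : i.val ≤ k := Nat.lt_succ_iff.1 i.isLt
    -- the component, in closed form
    have e : (prefixRungProj k N hkN (K⁻¹ • rescale K (P.langevinDrift N w)) -
        ((prefixRungProj k N hkN (rescale K w)).2,
          fun i => -(P₀⟦lam, β, k⟧.dPotential (k + 1) i (prefixRungProj k N hkN (rescale K w)).1))).2 i =
        K⁻¹ * ((K ^ 2)⁻¹ * (-P.dPotential N (Fin.castLE hkN i) w.1 -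
          γ * bathWeight N (Fin.castLE hkN i) * w.2 (Fin.castLE hkN i))) +
          P₀⟦lam, β, k⟧.dPotential (k + 1) i (fun j => K⁻¹ * w.1 (Fin.castLE hkN j)) := by
      simp only [Prod.snd_sub, Pi.sub_apply, prefixRungProj_snd, Prod.smul_snd, Pi.smul_apply,
        rescale_snd, smul_eq_mul, hYw, sub_neg_eq_add]
      rfl
    rw [e, SiteChain.dPotential_eq_closed, prefixLimit_dPotential_eq, hP, cellChain_deriv_U_eq]
    simp only [Fin.val_castLE, decide_eq_true_eq, cellChain_deriv_V_eq]
    -- name the data that occur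
    set a : ℝ := w.1 (Fin.castLE hkN i) with ha
    set pI : ℝ := w.2 (Fin.castLE hkN i) with hpIdef
    set bw : ℝ := bathWeight N (Fin.castLE hkN i) with hbwdef
    have haq : |a| ≤ Cq * K := hq _ hik
    have hpI : |pI| ≤ Cp * K ^ 2 := hp _ hik
    have hbw : 0 ≤ bw ∧ bw ≤ 2 := by
      rw [hbwdef]; unfold bathWeight; constructor <;> split_ifs <;> norm_num
    -- the neighbours
    have hleft : ∀ hi : 0 < i.val, |a - w.1 ⟨i.val - 1, by omega⟩| ≤ 2 * Cq * K ^ 2 := by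
      intro hi
      have h1 : |w.1 ⟨i.val - 1, by omega⟩| ≤ Cq * K := hq _ (by show i.val - 1 ≤ k; omega)
      calc |a - w.1 ⟨i.val - 1, by omega⟩| ≤ |a| + |w.1 ⟨i.val - 1, by omega⟩| := abs_sub _ _
        _ ≤ Cq * K + Cq * K := add_le_add haq h1
        _ ≤ 2 * Cq * K ^ 2 := by nlinarith
    have hright : ∀ hi : i.val + 1 < N, |w.1 ⟨i.val + 1, hi⟩ - a| ≤ (Cq + Ch + Cq) * K ^ 2 := by
      intro hi
      have h1 : |w.1 ⟨i.val + 1, hi⟩| ≤ (Cq + Ch) * K ^ 2 := by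
        rcases Nat.lt_or_ge (i.val + 1) (k + 1) with h | h
        · have := hq ⟨i.val + 1, hi⟩ (by show i.val + 1 ≤ k; omega)
          nlinarith [abs_nonneg (w.1 ⟨i.val + 1, hi⟩)]
        · have := hh ⟨i.val + 1, hi⟩ (by show i.val + 1 = k + 1; omega)
          nlinarith [abs_nonneg (w.1 ⟨i.val + 1, hi⟩)]
      calc |w.1 ⟨i.val + 1, hi⟩ - a| ≤ |w.1 ⟨i.val + 1, hi⟩| + |a| := abs_sub _ _
        _ ≤ (Cq + Ch) * K ^ 2 + Cq * K := add_le_add h1 haq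
        _ ≤ (Cq + Ch + Cq) * K ^ 2 := by nlinarith
    -- the residual: all cubic terms cancel
    have hres : K⁻¹ * ((K ^ 2)⁻¹ * (-(ω₂ * a + (if i.val < k then lam else 0) * a ^ 3 +
          (if h : 0 < i.val then
            (a - w.1 ⟨i.val - 1, by omega⟩) + (if i.val - 1 < k then β else 0) * (a - w.1 ⟨i.val - 1, by omega⟩) ^ 3
           else 0) -
          (if h : i.val + 1 < N then
            (w.1 ⟨i.val + 1, h⟩ - a) + (if i.val < k then β else 0) * (w.1 ⟨i.val + 1, h⟩ - a) ^ 3 else 0)) -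
          γ * bw * pI)) +
        (((if i.val < k then lam else 0) * (K⁻¹ * a) ^ 3 +
          (if h : 0 < i.val then β * (K⁻¹ * a - K⁻¹ * w.1 (Fin.castLE hkN ⟨i.val - 1, by omega⟩)) ^ 3 else 0)) -
          (if h : i.val + 1 < k + 1 then β * (K⁻¹ * w.1 (Fin.castLE hkN ⟨i.val + 1, h⟩) - K⁻¹ * a) ^ 3 else 0)) =
        K⁻¹ * ((K ^ 2)⁻¹ * (-(ω₂ * a) - γ * bw * pI -
          (if h : 0 < i.val then (a - w.1 ⟨i.val - 1, by omega⟩) else 0) +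
          (if h : i.val + 1 < N then (w.1 ⟨i.val + 1, h⟩ - a) else 0))) := by
      have eL : ∀ (hi : 0 < i.val), w.1 (Fin.castLE hkN ⟨i.val - 1, by omega⟩) = w.1 ⟨i.val - 1, by omega⟩ :=
        fun hi => rfl
      by_cases h0 : 0 < i.val <;> by_cases h1 : i.val < k
      · -- interior cell site
        have h2 : i.val + 1 < N := by omega
        have h3 : i.val + 1 < k + 1 := by omega
        have h4 : i.val - 1 < k := by omega
        have eR : w.1 (Fin.castLE hkN ⟨i.val + 1, h3⟩) = w.1 ⟨i.val + 1, h2⟩ := rfl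
        simp only [dif_pos h0, dif_pos h2, dif_pos h3, if_pos h4, if_pos h1, eL h0, eR]
        field_simp
        ring
      · -- the interface site `i = k > 0`
        have hik' : i.val = k := by omega
        have h3 : ¬ (i.val + 1 < k + 1) := by omega
        have h4 : i.val - 1 < k := by omega
        by_cases h2 : i.val + 1 < N
        · simp only [dif_pos h0, if_pos h4, if_neg h1, dif_neg h3, dif_pos h2, eL h0]
          field_simp
          ring
        · simp only [dif_pos h0, if_pos h4, if_neg h1, dif_neg h3, dif_neg h2, eL h0]
          field_simp
          ring
      · -- the bath site `i = 0 < k`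
        have h2 : i.val + 1 < N := by omega
        have h3 : i.val + 1 < k + 1 := by omega
        have eR : w.1 (Fin.castLE hkN ⟨i.val + 1, h3⟩) = w.1 ⟨i.val + 1, h2⟩ := rfl
        simp only [dif_neg h0, dif_pos h2, dif_pos h3, if_pos h1, eR]
        field_simp
        ring
      · -- `i = k = 0`
        have h3 : ¬ (i.val + 1 < k + 1) := by omega
        by_cases h2 : i.val + 1 < N
        · simp only [dif_neg h0, if_neg h1, dif_neg h3, dif_pos h2]
          field_simp
          ring
        · simp only [dif_neg h0, if_neg h1, dif_neg h3, dif_neg h2]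
          field_simp
          ring
    rw [Real.norm_eq_abs, hres]
    -- bound the residual
    have hX : |(-(ω₂ * a) - γ * bw * pI -
          (if h : 0 < i.val then (a - w.1 ⟨i.val - 1, by omega⟩) else 0) +
          (if h : i.val + 1 < N then (w.1 ⟨i.val + 1, h⟩ - a) else 0))| ≤ Cpert * K ^ 2 := by
      have haq2 : |a| ≤ Cq * K ^ 2 := haq.trans (by nlinarith)
      have t1 : |ω₂ * a| ≤ ω₂ * Cq * K ^ 2 := by
        rw [abs_mul, abs_of_pos hω, mul_assoc]; exact mul_le_mul_of_nonneg_left haq2 hω.le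
      have t2 : |γ * bw * pI| ≤ 2 * γ * Cp * K ^ 2 := by
        rw [abs_mul, abs_mul, abs_of_nonneg hγ, abs_of_nonneg hbw.1]
        calc γ * bw * |pI| ≤ γ * 2 * (Cp * K ^ 2) := by gcongr; exact hbw.2
          _ = 2 * γ * Cp * K ^ 2 := by ring
      have t3 : |(if h : 0 < i.val then (a - w.1 ⟨i.val - 1, by omega⟩) else 0)| ≤ 2 * Cq * K ^ 2 := by
        split_ifs with h
        · exact hleft h
        · rw [abs_zero]; positivity
      have t4 : |(if h : i.val + 1 < N then (w.1 ⟨i.val + 1, h⟩ - a) else 0)| ≤ (Cq + Ch + Cq) * K ^ 2 := by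
        split_ifs with h
        · exact hright h
        · rw [abs_zero]; positivity
      calc _ ≤ |-(ω₂ * a) - γ * bw * pI - (if h : 0 < i.val then (a - w.1 ⟨i.val - 1, by omega⟩) else 0)| +
            |(if h : i.val + 1 < N then (w.1 ⟨i.val + 1, h⟩ - a) else 0)| := abs_add_le _ _
        _ ≤ (|-(ω₂ * a) - γ * bw * pI| + |(if h : 0 < i.val then (a - w.1 ⟨i.val - 1, by omega⟩) else 0)|) +
            |(if h : i.val + 1 < N then (w.1 ⟨i.val + 1, h⟩ - a) else 0)| := by
            gcongr; exact abs_sub _ _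
        _ ≤ ((|-(ω₂ * a)| + |γ * bw * pI|) + |(if h : 0 < i.val then (a - w.1 ⟨i.val - 1, by omega⟩) else 0)|) +
            |(if h : i.val + 1 < N then (w.1 ⟨i.val + 1, h⟩ - a) else 0)| := by
            gcongr; exact abs_sub _ _
        _ ≤ ((ω₂ * Cq * K ^ 2 + 2 * γ * Cp * K ^ 2) + 2 * Cq * K ^ 2) + (Cq + Ch + Cq) * K ^ 2 := by
            rw [abs_neg]; gcongr
        _ = Cpert * K ^ 2 := by rw [hCpert]; ring
    exact abs_inv_mul_inv_sq_mul_le hK0 hX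

end Perturbation

end Literature.MathematicalPhysics.KineticTheory.HeatConduction
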